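import Mathlib.Algebra.GCDMonoid.Basic
import Mathlib.LinearAlgebra.Span.Basic
import Mathlib.LinearAlgebra.Pi
import Mathlib.RingTheory.UniqueFactorizationDomain.GCDMonoid
import Literature.NumberTheory.EllipticCurves.IwasawaAlgebra
import Literature.NumberTheory.GaloisRepresentations.NearlyOrdinaryPresentationProofs
import Literature.AlgebraicGeometry.Resolution.RegularLocalRingsUFD
import HarnessLib

/-!
# Route `ByReductionTypeAtTwo` (rung K4), crux `SupersingularRankZeroAtTwo` (item stmt-BirchSwinnertonDyer-19097), line
# `odd_blind_package`, slot 4 NF♭, sub-hand (hC-loc) of `HAND-TARGETS-NF-1.md`: **the kernel of a non-zero linear form on a free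
# module of rank two over a GCD domain is CYCLIC** — so `Ker Col♭ ⊂ H¹_Iw(ℚ₂, T₂E) ≅ Λ²` is `Λ ∙ z♭` once `Col♭` is `Λ`-linear and
# non-zero (pure algebra; cell `bsd-2adic`, LEAD ss-1 GEN 23; `--supports 19097`, helper)

HONEST FRAMING: THEOREMS ONLY (no definition, no named fact, no `sorry`, no instance); commutative algebra over a GCD domain `R`
and its instance `R = Λ = ℤ_p⟦T⟧` (a regular local ring of dimension `2`, hence factorial by Auslander–Buchsbaum — tree theorems
`NearlyOrdinaryPresentationCA.isRegularLocalRing_mvPowerSeries_dvr`, `Resolution.uniqueFactorizationMonoid_of_isRegularLocalRing`).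
Nothing about any curve; 19097 OPEN; BSD is proved for no curve.  bears_on: K4 (19097).

* `ker_form_fin_two_eq_span` — for `a b : R` not both zero, `{x : Fin 2 → R | a·x 0 + b·x 1 = 0} = R ∙ (−b′, a′)` where
  `a = d a′`, `b = d b′`, `gcd(a′, b′)` a unit (`extract_gcd`): the form `x ↦ a x₀ + b x₁` has CYCLIC kernel.
* `exists_ker_eq_span_singleton_of_linearEquiv_fin_two` — for any `R`-module `N` with `e : N ≃ₗ[R] (Fin 2 → R)` and any
  non-zero `f : N →ₗ[R] R`, `∃ z, ker f = R ∙ z`.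
* `iwasawaAlgebra_uniqueFactorizationMonoid` — `Λ = ℤ_p⟦T⟧` is factorial; `iwasawaAlgebra_exists_ker_eq_span_singleton_of_linearEquiv_fin_two`
  — the instance used by (hC-loc): a non-zero `Λ`-linear form on a free `Λ`-module of rank two has cyclic kernel.

References: [KitajimaOtsuki2018] Prop. 3.32 (the shape `(H¹(k_∞)/E^±)^∨ ≅ Λ`); [Matsumura1987] Thm. 20.3 (regular ⟹ UFD); [Washington1997] §13.2.
-/

set_option autoImplicit false
-- the Theorems namespace of this sub repeats the summit name by design (D-0017 nested layout)
set_option linter.dupNamespace false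

noncomputable section

open scoped Classical

namespace Summit.BirchSwinnertonDyer.BirchSwinnertonDyer.Theorems

namespace OddBlindNF

/-! ### §1 Over a GCD domain: the kernel of `x ↦ a x₀ + b x₁` on `R²` is cyclic -/

section GCD

variable {R : Type*} [CommRing R] [IsDomain R] [GCDMonoid R]

omit [IsDomain R] in
/-- In a GCD domain, if `gcd a′ b′` is a unit and `a′ ∣ b′ * y` then `a′ ∣ y`. [folklore] -/
theorem dvd_of_dvd_mul_of_isUnit_gcd {a' b' y : R} (hu : IsUnit (gcd a' b')) (h : a' ∣ b' * y) : a' ∣ y := by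
  have h1 : a' ∣ gcd a' b' * y := dvd_gcd_mul_of_dvd_mul h
  obtain ⟨u, hu'⟩ := hu
  rw [← hu'] at h1
  exact (Units.dvd_mul_left).mp h1

/-- **The kernel of a non-zero linear form on `R²` over a GCD domain is cyclic.**  For `a b : R` not both zero there is
`v : Fin 2 → R` with `{x | a * x 0 + b * x 1 = 0} = {t • v}`: writing `a = d a′`, `b = d b′` with `gcd(a′,b′)` a unit (`extract_gcd`),
`v = (−b′, a′)`. [folklore] -/
theorem ker_form_fin_two_eq_span (a b : R) (hab : a ≠ 0 ∨ b ≠ 0) :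
    ∃ v : Fin 2 → R, ∀ x : Fin 2 → R, a * x 0 + b * x 1 = 0 ↔ ∃ t : R, x = t • v := by
  obtain ⟨a', b', ha, hb, hu⟩ := extract_gcd a b
  set d := gcd a b with hd
  have hd0 : d ≠ 0 := by
    intro h0
    rcases hab with ha0 | hb0
    · exact ha0 (by rw [ha, h0, zero_mul])
    · exact hb0 (by rw [hb, h0, zero_mul])
  refine ⟨![-b', a'], fun x ↦ ⟨fun hx ↦ ?_, fun ⟨t, ht⟩ ↦ ?_⟩⟩
  · -- `d (a′ x₀ + b′ x₁) = 0` ⟹ `a′ x₀ = − b′ x₁`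
    have h1 : a' * x 0 + b' * x 1 = 0 := by
      have : d * (a' * x 0 + b' * x 1) = 0 := by
        rw [mul_add, ← mul_assoc, ← mul_assoc, ← ha, ← hb]; exact hx
      exact (mul_eq_zero.mp this).resolve_left hd0
    by_cases ha' : a' = 0
    · -- then `b′` is a unit (gcd 0 b′ ~ b′) and `x₁ = 0`
      have hb'u : IsUnit b' := by
        have h : IsUnit (gcd a' b') := hu
        rw [ha'] at h
        exact (gcd_zero_left' b').isUnit_iff.mp h
      have hx1 : x 1 = 0 := by
        rw [ha', zero_mul, zero_add] at h1
        exact (hb'u.mul_right_eq_zero).mp h1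
      obtain ⟨u, hu'⟩ := hb'u
      refine ⟨-(x 0 * ↑u⁻¹), ?_⟩
      funext i
      fin_cases i
      · simp only [Fin.zero_eta, Fin.isValue, Pi.smul_apply, Matrix.cons_val_zero, smul_eq_mul]
        rw [← hu', neg_mul, mul_neg, neg_neg, mul_assoc, Units.inv_mul, mul_one]
      · simp only [Fin.mk_one, Fin.isValue, Pi.smul_apply, Matrix.cons_val_one, Matrix.cons_val_zero, smul_eq_mul]
        rw [hx1, ha', mul_zero]
    · -- `a′ ∣ b′ x₁`, so `x₁ = a′ t` and then `x₀ = − b′ t`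
      have hdvd : a' ∣ b' * x 1 := ⟨-(x 0), by linear_combination h1⟩
      obtain ⟨t, ht⟩ := dvd_of_dvd_mul_of_isUnit_gcd hu hdvd
      refine ⟨t, ?_⟩
      have hx0 : x 0 = t * (-b') := by
        have : a' * x 0 = a' * (t * (-b')) := by linear_combination h1 - b' * ht
        exact mul_left_cancel₀ ha' this
      funext i
      fin_cases i
      · simp only [Fin.zero_eta, Fin.isValue, Pi.smul_apply, Matrix.cons_val_zero, smul_eq_mul]
        rw [hx0]
      · simp only [Fin.mk_one, Fin.isValue, Pi.smul_apply, Matrix.cons_val_one, Matrix.cons_val_zero, smul_eq_mul]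
        rw [ht, mul_comm]
  · rw [ht]
    simp only [Pi.smul_apply, Matrix.cons_val_zero, Matrix.cons_val_one, smul_eq_mul]
    rw [ha, hb]
    ring

/-- **The kernel of a non-zero linear form on a free module of rank two over a GCD domain is cyclic** (module form of
`ker_form_fin_two_eq_span`, transported along any `e : N ≃ₗ[R] (Fin 2 → R)`). [folklore] -/
theorem exists_ker_eq_span_singleton_of_linearEquiv_fin_two {N : Type*} [AddCommGroup N] [Module R N]
    (e : N ≃ₗ[R] (Fin 2 → R)) (f : N →ₗ[R] R) (hf : f ≠ 0) :
    ∃ z : N, LinearMap.ker f = Submodule.span R {z} := by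
  -- the form on `R²`: `g x = f (e⁻¹ x) = a x₀ + b x₁` with `a = g e₀`, `b = g e₁`
  set g : (Fin 2 → R) →ₗ[R] R := f.comp e.symm.toLinearMap with hg
  set a : R := g (Pi.single 0 1) with ha
  set b : R := g (Pi.single 1 1) with hb
  have hgx : ∀ x : Fin 2 → R, g x = a * x 0 + b * x 1 := by
    intro x
    have hx : x = x 0 • (Pi.single 0 1 : Fin 2 → R) + x 1 • (Pi.single 1 1 : Fin 2 → R) := by
      funext i
      fin_cases i <;> simp
    conv_lhs => rw [hx]
    rw [map_add, map_smul, map_smul, smul_eq_mul, smul_eq_mul, ← ha, ← hb]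
    ring
  have hab : a ≠ 0 ∨ b ≠ 0 := by
    by_contra h
    push Not at h
    apply hf
    ext n
    have := hgx (e n)
    rw [h.1, h.2, zero_mul, zero_mul, add_zero, hg, LinearMap.comp_apply, LinearEquiv.coe_toLinearMap,
      LinearEquiv.symm_apply_apply] at this
    rw [this, LinearMap.zero_apply]
  obtain ⟨v, hv⟩ := ker_form_fin_two_eq_span a b hab
  refine ⟨e.symm v, ?_⟩
  ext n
  rw [LinearMap.mem_ker, Submodule.mem_span_singleton]
  have key : f n = 0 ↔ ∃ t : R, e n = t • v := by
    rw [← hv (e n), ← hgx (e n), hg, LinearMap.comp_apply, LinearEquiv.coe_toLinearMap, LinearEquiv.symm_apply_apply]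
  rw [key]
  constructor
  · rintro ⟨t, ht⟩
    exact ⟨t, by rw [← LinearEquiv.map_smul, ← ht, LinearEquiv.symm_apply_apply]⟩
  · rintro ⟨t, ht⟩
    exact ⟨t, by rw [← ht, LinearEquiv.map_smul, LinearEquiv.apply_symm_apply]⟩

end GCD

/-! ### §2 The instance `R = Λ = ℤ_p⟦T⟧` -/

section Iwasawa

open Literature.NumberTheory.EllipticCurves

variable (p : ℕ) [Fact p.Prime]

/-- **`Λ = ℤ_p⟦T⟧` is factorial**: `ℤ_p` is a DVR, `ℤ_p⟦X_0⟧` is a regular local ring (tree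
`NearlyOrdinaryPresentationCA.isRegularLocalRing_mvPowerSeries_dvr ℤ_[p] 1`, transported along `Fin 1 ≃ Unit`), and regular local rings
are UFDs (Auslander–Buchsbaum, tree `Resolution.uniqueFactorizationMonoid_of_isRegularLocalRing`).  Same term as the tree's
`uniqueFactorizationMonoid_unrSeries` with `ℤ_p` for `W(𝔽̄_p)`. [cite: Matsumura1987, Thm. 20.3 with Thm. 19.5] -/
theorem iwasawaAlgebra_uniqueFactorizationMonoid :
    UniqueFactorizationMonoid (IwasawaAlgebra p) := by
  haveI := Literature.NumberTheory.GaloisRepresentations.NearlyOrdinaryPresentationCA.isRegularLocalRing_mvPowerSeries_dvr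
    ℤ_[p] 1
  exact Literature.AlgebraicGeometry.Resolution.uniqueFactorizationMonoid_of_isRegularLocalRing _
    (IsRegularLocalRing.of_ringEquiv (MvPowerSeries.renameEquiv ℤ_[p] finOneEquiv.symm).toRingEquiv.symm)

/-- **(hC-loc algebra) A non-zero `Λ`-linear form on a free `Λ`-module of rank two has CYCLIC kernel** (`Λ = ℤ_p⟦T⟧`; applied to
`Col♭ : H¹_Iw(ℚ₂, T₂E) ≅ Λ² → Λ` it gives `Ker Col♭ = Λ ∙ z♭`). [cite: KitajimaOtsuki2018, Prop. 3.32 (shape)] [cite: Matsumura1987, Thm. 20.3] -/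
theorem iwasawaAlgebra_exists_ker_eq_span_singleton_of_linearEquiv_fin_two
    {N : Type*} [AddCommGroup N] [Module (IwasawaAlgebra p) N]
    (e : N ≃ₗ[IwasawaAlgebra p] (Fin 2 → IwasawaAlgebra p)) (f : N →ₗ[IwasawaAlgebra p] IwasawaAlgebra p) (hf : f ≠ 0) :
    ∃ z : N, LinearMap.ker f = Submodule.span (IwasawaAlgebra p) {z} := by
  haveI := iwasawaAlgebra_uniqueFactorizationMonoid p
  letI : GCDMonoid (IwasawaAlgebra p) := UniqueFactorizationMonoid.toGCDMonoid (IwasawaAlgebra p)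
  exact exists_ker_eq_span_singleton_of_linearEquiv_fin_two e f hf

end Iwasawa

end OddBlindNF

end Summit.BirchSwinnertonDyer.BirchSwinnertonDyer.Theorems

end
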